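import Summits.Ventures.HodgeRepro2.Signs

/-!
# HodgeRepro2 — the hermitian data of the transfer exist (proved)

Blind re-derivation cell `pub-hodge-repro2`, seat p2 (file 4; imports `Signs.lean`, which imports
`Hypothesis.lean`).  Everything here is PROVED.

## Main result
`picardHermitianFormExists K τ₁ : PicardHermitianFormExists K τ₁` — for every CM-field `K` and
every complex embedding `τ₁ : K → ℂ` there is a hermitian form `H` on `K³` with
`signatureAt τ₁ H = (2,1)` and `H` definite at every other infinite place: `H = diag[1, 1, a]`,
`a` in the maximal real subfield, `a < 0` at the real place below `τ₁` and `a > 0` at the other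
real places (weak approximation, `Signs.lean`).  This is the existence half of the
classification of hermitian spaces over a CM extension (Landherr; printed: Shimura, *Arithmetic
of Hermitian forms*, Doc. Math. 13 (2008) 739–774, Theorem 2.2(ii) p. 748 — "Given n, ε, and
{σ_v} satisfying (2.1a, b), there exists a hermitian space (V, ϕ) such that dim(V) = n,
ε ∈ d0(ϕ), and s_v(ϕ) = σ_v for every v ∈ r0"), specialised to `n = 3`, `σ_{v₁} = 1`,
`σ_v = 3` otherwise; it is the hermitian space of the compact Picard modular surface of the
transfer ([DR15] Introduction: signature `(n,1)` at one infinite place and `(n+1,0)` or `(0,n+1)`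
at the others, `n = 2`).

## Tools (all proved)
`eigenvalues_map_univ_of_eq_diagonal` / `card_filter_eigenvalues_of_eq_diagonal` /
`signatureAt_eq_of_map_eq_diagonal`: the signature of a form that becomes a real diagonal matrix
under `τ` is read off the signs of the diagonal entries (via `Matrix.charpoly_diagonal` and
`Matrix.IsHermitian.roots_charpoly_eq_eigenvalues`); `card_filter_eigenvalues_of_charpoly_eq`,
`map_conjugate_eq_transpose`, `signatureAt_conjugate`, `signatureAt_eq_of_mk_eq`: the signature
depends only on the infinite place of the embedding (`τ̄(H) = τ(H)ᵀ`, `Matrix.charpoly_transpose`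
— the remark in the docstring of `signatureAt`); `embedding_algebraMap_eq_re`: a complex
embedding of a CM-field restricted to the maximal real subfield is the real place below it.
-/

namespace Summit.Ventures.HodgeRepro2.ShimuraData

open NumberField Matrix

section DiagonalSignature

open Polynomial

variable {m : ℕ}

/-- The eigenvalues of a real diagonal matrix (as a multiset) are its diagonal entries. -/
theorem eigenvalues_map_univ_of_eq_diagonal (A : Matrix (Fin m) (Fin m) ℂ) (hA : A.IsHermitian)
    (d : Fin m → ℝ) (hd : A = Matrix.diagonal fun i => (d i : ℂ)) :
    Multiset.map hA.eigenvalues Finset.univ.val = Multiset.map d Finset.univ.val := by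
  have h1 := hA.roots_charpoly_eq_eigenvalues
  have h2 : A.charpoly.roots = Multiset.map (fun i => (d i : ℂ)) Finset.univ.val := by
    have hc : (fun i : Fin m => (X - C (d i : ℂ))) = (fun a : ℂ => X - C a) ∘ fun i => (d i : ℂ) :=
      rfl
    rw [hd, Matrix.charpoly_diagonal, Finset.prod_eq_multiset_prod, hc, ← Multiset.map_map,
      roots_multiset_prod_X_sub_C]
  rw [h2] at h1
  have h3 : Multiset.map (fun x : ℝ => (x : ℂ)) (Multiset.map d Finset.univ.val) =
      Multiset.map (fun x : ℝ => (x : ℂ)) (Multiset.map hA.eigenvalues Finset.univ.val) := by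
    rw [Multiset.map_map, Multiset.map_map]
    exact h1
  exact (Multiset.map_injective Complex.ofReal_injective h3).symm

/-- Counting positive / negative eigenvalues of a real diagonal matrix = counting positive /
negative diagonal entries. -/
theorem card_filter_eigenvalues_of_eq_diagonal (A : Matrix (Fin m) (Fin m) ℂ)
    (hA : A.IsHermitian) (d : Fin m → ℝ) (hd : A = Matrix.diagonal fun i => (d i : ℂ))
    (p : ℝ → Prop) [DecidablePred p] :
    (Finset.univ.filter fun i => p (hA.eigenvalues i)).card =
      (Finset.univ.filter fun i => p (d i)).card := by
  have h := eigenvalues_map_univ_of_eq_diagonal A hA d hd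
  have key : ∀ f : Fin m → ℝ, (Finset.univ.filter fun i => p (f i)).card =
      Multiset.countP p (Multiset.map f Finset.univ.val) := by
    intro f
    rw [Multiset.countP_map, Finset.card_def, Finset.filter_val]
  rw [key, key, h]

/-- Two hermitian matrices with the same characteristic polynomial have the same numbers of
eigenvalues satisfying any predicate (the eigenvalue multisets coincide). -/
theorem card_filter_eigenvalues_of_charpoly_eq (A B : Matrix (Fin m) (Fin m) ℂ)
    (hA : A.IsHermitian) (hB : B.IsHermitian) (h : A.charpoly = B.charpoly)
    (p : ℝ → Prop) [DecidablePred p] :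
    (Finset.univ.filter fun i => p (hA.eigenvalues i)).card =
      (Finset.univ.filter fun i => p (hB.eigenvalues i)).card := by
  have h1 := hA.roots_charpoly_eq_eigenvalues
  have h2 := hB.roots_charpoly_eq_eigenvalues
  rw [h] at h1
  have h3 : Multiset.map (fun x : ℝ => (x : ℂ)) (Multiset.map hA.eigenvalues Finset.univ.val) =
      Multiset.map (fun x : ℝ => (x : ℂ)) (Multiset.map hB.eigenvalues Finset.univ.val) := by
    rw [Multiset.map_map, Multiset.map_map]
    exact h1.symm.trans h2
  have h4 := Multiset.map_injective Complex.ofReal_injective h3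
  have key : ∀ f : Fin m → ℝ, (Finset.univ.filter fun i => p (f i)).card =
      Multiset.countP p (Multiset.map f Finset.univ.val) := by
    intro f
    rw [Multiset.countP_map, Finset.card_def, Finset.filter_val]
  rw [key, key, h4]

variable (K : Type*) [Field K] [NumberField K] [IsCMField K]

/-- `τ̄(H) = τ(H)ᵀ` for a hermitian `H` over the CM-field `K`. -/
theorem map_conjugate_eq_transpose {H : Matrix (Fin m) (Fin m) K} (hH : IsHermitianForm K H)
    (τ : K →+* ℂ) : H.map ((starRingEnd ℂ).comp τ) = (H.map τ)ᵀ := by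
  ext i j
  have h : conjTransposeK K H i j = H i j := by rw [hH]
  simp only [conjTransposeK, Matrix.transpose_apply, Matrix.map_apply] at h
  simp only [Matrix.map_apply, Matrix.transpose_apply, RingHom.comp_apply, ← h,
    IsCMField.complexEmbedding_complexConj, Complex.conj_conj]

/-- The signature does not depend on the choice of embedding within an infinite place:
`signatureAt (conj ∘ τ) H = signatureAt τ H` (via `Matrix.charpoly_transpose`). -/
theorem signatureAt_conjugate {H : Matrix (Fin m) (Fin m) K} (hH : IsHermitianForm K H)
    (τ : K →+* ℂ) : signatureAt K ((starRingEnd ℂ).comp τ) H = signatureAt K τ H := by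
  have hA := isHermitian_map_of_isHermitianForm hH ((starRingEnd ℂ).comp τ)
  have hB := isHermitian_map_of_isHermitianForm hH τ
  have hc : (H.map ((starRingEnd ℂ).comp τ)).charpoly = (H.map τ).charpoly := by
    rw [map_conjugate_eq_transpose K hH τ, Matrix.charpoly_transpose]
  unfold signatureAt
  rw [dif_pos hA, dif_pos hB]
  rw [card_filter_eigenvalues_of_charpoly_eq _ _ hA hB hc (fun x => 0 < x),
    card_filter_eigenvalues_of_charpoly_eq _ _ hA hB hc (fun x => x < 0)]

/-- `signatureAt` depends only on the infinite place of the embedding. -/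
theorem signatureAt_eq_of_mk_eq {H : Matrix (Fin m) (Fin m) K} (hH : IsHermitianForm K H)
    {τ τ' : K →+* ℂ} (h : InfinitePlace.mk τ = InfinitePlace.mk τ') :
    signatureAt K τ H = signatureAt K τ' H := by
  rcases InfinitePlace.mk_eq_iff.mp h with h | h
  · rw [h]
  · rw [← h]
    exact (signatureAt_conjugate K hH τ).symm

/-- `signatureAt` of a form whose image under `τ` is a real diagonal matrix: the numbers of
positive and negative diagonal entries. -/
theorem signatureAt_eq_of_map_eq_diagonal {H : Matrix (Fin m) (Fin m) K}
    (hH : IsHermitianForm K H) (τ : K →+* ℂ) (d : Fin m → ℝ)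
    (hd : H.map τ = Matrix.diagonal fun i => (d i : ℂ)) :
    signatureAt K τ H =
      ((Finset.univ.filter fun i => 0 < d i).card, (Finset.univ.filter fun i => d i < 0).card) := by
  have hA := isHermitian_map_of_isHermitianForm hH τ
  unfold signatureAt
  rw [dif_pos hA]
  rw [card_filter_eigenvalues_of_eq_diagonal (H.map τ) hA d hd (fun x => 0 < x),
    card_filter_eigenvalues_of_eq_diagonal (H.map τ) hA d hd (fun x => x < 0)]

end DiagonalSignature

section PicardExists

variable (K : Type*) [Field K] [NumberField K] [IsCMField K]

/-- A complex embedding of a CM-field evaluated on the maximal real subfield is the (real) value of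
the real place below it: `τ(x) = v(x)` with `v = equivInfinitePlace (mk τ)`. -/
theorem embedding_algebraMap_eq_re (τ : K →+* ℂ) (x : maximalRealSubfield K) :
    τ (algebraMap (maximalRealSubfield K) K x) =
      (((IsCMField.equivInfinitePlace K (InfinitePlace.mk τ)).embedding x).re : ℂ) := by
  set w : InfinitePlace K := InfinitePlace.mk τ with hw
  set v : InfinitePlace (maximalRealSubfield K) := IsCMField.equivInfinitePlace K w with hv
  have h0 : v = InfinitePlace.mk (w.embedding.comp (algebraMap (maximalRealSubfield K) K)) := by
    rw [hv, IsCMField.equivInfinitePlace_apply, ← InfinitePlace.comap_mk,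
      InfinitePlace.mk_embedding]
  have h1 : v.embedding = w.embedding.comp (algebraMap (maximalRealSubfield K) K) := by
    rw [h0]
    exact InfinitePlace.embedding_mk_eq_of_isReal (IsTotallyReal.complexEmbedding_isReal _)
  have h2 : τ (algebraMap (maximalRealSubfield K) K x) =
      w.embedding (algebraMap (maximalRealSubfield K) K x) :=
    embedding_algebraMap_eq_of_mk_eq K (by rw [hw, InfinitePlace.mk_embedding]) x
  rw [h2, h1, RingHom.comp_apply]
  exact (Complex.conj_eq_iff_re.mp
    (Complex.conj_eq_iff_im.mpr (im_embedding_algebraMap_eq_zero K w.embedding x))).symm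

/-- The diagonal form `diag[1, 1, a]` with `a` in the maximal real subfield is hermitian. -/
theorem isHermitianForm_diagonal_one_one (a : maximalRealSubfield K) :
    IsHermitianForm K (Matrix.diagonal ![1, 1, algebraMap (maximalRealSubfield K) K a]) := by
  unfold IsHermitianForm conjTransposeK
  rw [Matrix.diagonal_map (map_zero _), Matrix.diagonal_transpose]
  congr 1
  funext i
  fin_cases i
  · simp
  · simp
  · have hcoe : algebraMap (maximalRealSubfield K) K a = (a : K) := rfl
    simp [hcoe, IsCMField.complexConj_apply_eq_self]

/-- **The hermitian data of the transfer exist** (`PicardHermitianFormExists`, now a theorem):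
for every CM-field `K` and every complex embedding `τ₁` there is a hermitian form on `K³` of
signature `(2,1)` at `τ₁` and definite at every other infinite place, namely `diag[1, 1, a]` with
`a` in the maximal real subfield negative at the real place below `τ₁` and positive elsewhere
(weak approximation, `exists_re_sign_prescribed`).  Printed counterpart: Shimura, Doc. Math. 13
(2008), Theorem 2.2(ii) p. 748 and its proof (`ϕ = c ϕ₁`). -/
theorem picardHermitianFormExists (τ₁ : K →+* ℂ) : PicardHermitianFormExists K τ₁ := by
  classical
  set v₁ : InfinitePlace (maximalRealSubfield K) :=
    IsCMField.equivInfinitePlace K (InfinitePlace.mk τ₁) with hv₁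
  obtain ⟨a, ha⟩ := exists_re_sign_prescribed (maximalRealSubfield K) fun v => decide (v ≠ v₁)
  refine ⟨Matrix.diagonal ![1, 1, algebraMap (maximalRealSubfield K) K a],
    isHermitianForm_diagonal_one_one K a, ?_⟩
  -- the signature at any embedding `τ` is read off the real value `r τ` of `a` below `τ`
  have hdiag : ∀ τ : K →+* ℂ,
      (Matrix.diagonal ![1, 1, algebraMap (maximalRealSubfield K) K a]).map τ =
        Matrix.diagonal fun i =>
          ((![1, 1, ((IsCMField.equivInfinitePlace K (InfinitePlace.mk τ)).embedding a).re] i : ℝ)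
            : ℂ) := by
    intro τ
    rw [Matrix.diagonal_map (map_zero _)]
    congr 1
    funext i
    fin_cases i
    · simp
    · simp
    · simp [embedding_algebraMap_eq_re K τ a]
  have hsig : ∀ τ : K →+* ℂ, signatureAt K τ
      (Matrix.diagonal ![1, 1, algebraMap (maximalRealSubfield K) K a]) =
      ((Finset.univ.filter fun i =>
          0 < ![1, 1, ((IsCMField.equivInfinitePlace K (InfinitePlace.mk τ)).embedding a).re] i).card,
       (Finset.univ.filter fun i =>
          ![1, 1, ((IsCMField.equivInfinitePlace K (InfinitePlace.mk τ)).embedding a).re] i < 0).card) :=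
    fun τ => signatureAt_eq_of_map_eq_diagonal K (isHermitianForm_diagonal_one_one K a) τ _ (hdiag τ)
  refine ⟨?_, ?_⟩
  · -- at `τ₁`: `a < 0`, signature `(2, 1)`
    have hneg : (v₁.embedding a).re < 0 := by
      have h := ha v₁
      have : ¬ (0 < (v₁.embedding a).re) := fun h' => by simpa using h.1.mp h'
      exact lt_of_le_of_ne (not_lt.mp this) h.2
    rw [hsig τ₁, ← hv₁, Finset.card_filter, Finset.card_filter, Fin.sum_univ_three,
      Fin.sum_univ_three]
    simp [hneg, not_lt.mpr hneg.le]
  · -- elsewhere: `a > 0`, signature `(3, 0)`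
    intro τ hτ
    set v : InfinitePlace (maximalRealSubfield K) :=
      IsCMField.equivInfinitePlace K (InfinitePlace.mk τ) with hv
    have hne : v ≠ v₁ := by
      rw [hv, hv₁]
      exact fun h => hτ ((IsCMField.equivInfinitePlace K).injective h)
    have hpos : 0 < (v.embedding a).re := (ha v).1.mpr (by simpa using hne)
    left
    rw [hsig τ, ← hv, Finset.card_filter, Finset.card_filter, Fin.sum_univ_three,
      Fin.sum_univ_three]
    simp [hpos, not_lt.mpr hpos.le]

end PicardExists

end Summit.Ventures.HodgeRepro2.ShimuraData
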